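import Summits.ResolutionOfSingularities.ResolutionOfSingularities.Theorems.PurelyInseparableDim4ResConeLayer
import Summits.ResolutionOfSingularities.ResolutionOfSingularities.Theorems.PurelyInseparableDim4ResConeShearPolar
import HarnessLib
import HarnessLib.Audit.Tags

/-!
# Purely inseparable four-folds — the TAME CONE AT A CONSTANT-`d` STEP, III: the polar-kernel dimension
# drops (idea-4 I-4-6 (VT)(iii)), rank-one kernels force FREE steps ((E1-FREE)), and the free-tail lemma
# closes the `e_G ≤ 1` case of K2(p) for every prime

[OURS · counted 0 · cell `res-dim4-pi` · desk WORD #55 (a) / crit-4 g2 V-A4-13 (FILES 2–3 GO, price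
P-A4-13a) · seat res-dim4-p-12 g2.]  Nothing here proves K2(p), `NoIsolatedTrap p p` or resolution of
singularities in dimension ≥ 4 / characteristic `p`.

Setting (`…ResCone*`): presented state `s`, `x^r ∣ F`, `q < ord₀ F = o < 2q`, residual cone `g = resForm s`,
POLAR KERNEL `resVertex s = additiveSubspace g` (contains `Dir V(g)`, equals it for `deg g < p`;
`e_G(s) := finrank (resVertex s)`), point step at the chart point `b` of the `x_j`-chart (`b_j = 0`),
new state `s′`, shade kept.

Main results (namespace `…PIDim4.ResCone`):
* **`finrank_resVertex_step_inf_hyperplane_add_one_le`** (trace bound) and **`finrank_resVertex_step_le`**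
  ((VT)(iii)): `finrank (resVertex s′ ⊓ {w_j = 0}) + 1 ≤ finrank (resVertex s)`, hence
  `e_G(s′) ≤ e_G(s)` — from FILE 3b-ii's injection `resVertex s′ ⊓ H_j ↪ A(shear g)`, `e_j ∈ A(shear g)`
  (the sheared cone is `x_j`-free, (VT)(i)) and `dim A(shear g) = dim A(g)` (FILE 3b-i);
* **`not_satellite_of_finrank_le_one`** ((E1-FREE)): if `e_G(s) ≤ 1` and the two consecutive band steps
  `s → s′ → s″` both keep the shade, the second step is NOT a satellite of the first (its direction has a
  non-zero `x_j`-component): `resVertex s′ ⊓ H_j = 0` while (VT)(i) puts the direction in `resVertex s′`;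
* **`no_isolated_chain_eventually_vertex_le_one`**, **`noConstantShadeTrap_of_vertex_le_one`** — with the
  tree's free-tail lemma FT(p,p) (`FreeTailProof.noIsolatedFreeTailAt_self`: satellites recur along every
  isolated chain): for EVERY prime `p` there is no isolated above-floor `Step0 p` chain with `x^{r₀} ∣ F₀`,
  eventually constant shade and eventually `e_G ≤ 1`.  (The cases `e_G ∈ {2, 3, 4}` of K2(p) stay OPEN.)
bears_on: LADDER-RESOLUTION:D157-DOOR2 (res-dim4-pi · K2(p) = `RidgeBudget.NoAboveFloorTrap p p`).
Supports stmt-ResolutionOfSingularities-16155 (helper).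
-/

set_option linter.dupNamespace false -- mandated namespace of this single-conjunct summit

noncomputable section

namespace Summit.ResolutionOfSingularities.ResolutionOfSingularities.Theorems.PIDim4

namespace ResCone

open MvPolynomial Finset
open Literature.AlgebraicGeometry.Resolution
open Literature.AlgebraicGeometry.Resolution.CentreBlowup
open Literature.AlgebraicGeometry.Resolution.Hauser2010
open Literature.AlgebraicGeometry.Resolution.HauserPerlega2019
open PointBlowup (polarMap additiveSubspace direction)

variable {K : Type} [Field K]

/-! ## 1. (VT)(iii): the polar-kernel dimension drops at a shade-keeping band step -/

section VertexDrop

variable [DecidableEq K]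

/-- **Trace bound** ((VT)(iii) with the exceptional hyperplane): at a shade-keeping band step in the
`x_j`-chart, `finrank (resVertex s′ ⊓ {w_j = 0}) + 1 ≤ finrank (resVertex s)`.
[OURS] [cite: CossartJannsenSaito2020, Thm. 3.10(4), Thm. 9.3] -/
theorem finrank_resVertex_step_inf_hyperplane_add_one_le {q : ℕ} (j : Fin 4) {b : Fin 4 → K}
    (hbj : b j = 0) {s : State K} {o : ℕ} (ho : ordZero s.F = o) (hr : ∀ d ∈ s.F.support, s.r ≤ d)
    (hqo : q < o) (ho2 : o < 2 * q) (heq : (CentreBlowup.step q Finset.univ j b s).shade = s.shade) :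
    Module.finrank K ↥(resVertex (CentreBlowup.step q Finset.univ j b s) ⊓ hyperplane j) + 1 ≤
      Module.finrank K (resVertex s) := by
  have hfree := shear_resForm_free_of_shade_eq j hbj ho hr hqo ho2 heq
  have hle : resVertex (CentreBlowup.step q Finset.univ j b s) ⊓ hyperplane j ≤
      additiveSubspace (shear j b (resForm s)) ⊓ hyperplane j :=
    le_inf (resVertex_step_inf_hyperplane_le j hbj ho hr hqo ho2 heq) inf_le_right
  have h1 := Submodule.finrank_mono hle
  have h2 := finrank_inf_hyperplane_add_one (additiveSubspace (shear j b (resForm s))) j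
    (single_mem_additiveSubspace_of_free hfree) (by rw [Pi.single_eq_same]; exact one_ne_zero)
  have h3 : Module.finrank K (additiveSubspace (shear j b (resForm s))) =
      Module.finrank K (resVertex s) := finrank_additiveSubspace_shear j hbj (resForm s)
  omega

/-- **(VT)(iii) — THE POLAR-KERNEL DIMENSION NEVER RISES at a shade-keeping band step**:
`e_G(s′) ≤ e_G(s)`. [OURS] [cite: CossartJannsenSaito2020, Thm. 3.10(4), Thm. 9.3] -/
theorem finrank_resVertex_step_le {q : ℕ} (j : Fin 4) {b : Fin 4 → K} (hbj : b j = 0) {s : State K}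
    {o : ℕ} (ho : ordZero s.F = o) (hr : ∀ d ∈ s.F.support, s.r ≤ d) (hqo : q < o) (ho2 : o < 2 * q)
    (heq : (CentreBlowup.step q Finset.univ j b s).shade = s.shade) :
    Module.finrank K (resVertex (CentreBlowup.step q Finset.univ j b s)) ≤
      Module.finrank K (resVertex s) :=
  le_trans (finrank_le_finrank_inf_hyperplane_add_one _ j)
    (finrank_resVertex_step_inf_hyperplane_add_one_le j hbj ho hr hqo ho2 heq)

/-- With `e_G(s) ≤ 1` the new polar kernel meets the exceptional hyperplane `{w_j = 0}` trivially.
[OURS] -/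
theorem resVertex_step_inf_hyperplane_eq_bot {q : ℕ} (j : Fin 4) {b : Fin 4 → K} (hbj : b j = 0)
    {s : State K} {o : ℕ} (ho : ordZero s.F = o) (hr : ∀ d ∈ s.F.support, s.r ≤ d) (hqo : q < o)
    (ho2 : o < 2 * q) (heq : (CentreBlowup.step q Finset.univ j b s).shade = s.shade)
    (he : Module.finrank K (resVertex s) ≤ 1) :
    resVertex (CentreBlowup.step q Finset.univ j b s) ⊓ hyperplane j = ⊥ := by
  have h := finrank_resVertex_step_inf_hyperplane_add_one_le j hbj ho hr hqo ho2 heq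
  exact Submodule.finrank_eq_zero.mp (by omega)

/-! ## 2. (E1-FREE): a rank-`≤ 1` polar kernel forbids a satellite at the next shade-keeping step -/

/-- **(E1-FREE)**: two consecutive shade-keeping band steps `s →(j₀, b₀) s′ →(j₁, b₁) s″` with
`e_G(s) ≤ 1` — the second step is not a satellite of the first (`¬ (j₁ ≠ j₀ ∧ (b₁)_{j₀} = 0)`): otherwise
its direction `e_{j₁} + b₁` lies in `resVertex s′` ((VT)(i)) and in `{w_{j₀} = 0}`, i.e. in `0`.
[OURS] [cite: CossartJannsenSaito2020, Thm. 3.14] -/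
theorem not_satellite_of_finrank_le_one {q : ℕ} {j₀ j₁ : Fin 4} {b₀ b₁ : Fin 4 → K} (hb₀ : b₀ j₀ = 0)
    (hb₁ : b₁ j₁ = 0) {s : State K} {o₀ o₁ : ℕ} (ho₀ : ordZero s.F = o₀)
    (hr₀ : ∀ d ∈ s.F.support, s.r ≤ d) (hqo₀ : q < o₀) (ho₀2 : o₀ < 2 * q)
    (heq₀ : (CentreBlowup.step q Finset.univ j₀ b₀ s).shade = s.shade)
    (ho₁ : ordZero (CentreBlowup.step q Finset.univ j₀ b₀ s).F = o₁)
    (hr₁ : ∀ d ∈ (CentreBlowup.step q Finset.univ j₀ b₀ s).F.support,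
      (CentreBlowup.step q Finset.univ j₀ b₀ s).r ≤ d)
    (hqo₁ : q < o₁) (ho₁2 : o₁ < 2 * q)
    (heq₁ : (CentreBlowup.step q Finset.univ j₁ b₁ (CentreBlowup.step q Finset.univ j₀ b₀ s)).shade =
      (CentreBlowup.step q Finset.univ j₀ b₀ s).shade)
    (he : Module.finrank K (resVertex s) ≤ 1) : ¬ (j₁ ≠ j₀ ∧ b₁ j₀ = 0) := by
  rintro ⟨hj, hb⟩
  have hbot := resVertex_step_inf_hyperplane_eq_bot j₀ hb₀ ho₀ hr₀ hqo₀ ho₀2 heq₀ he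
  have hdir : direction j₁ b₁ ∈ resVertex (CentreBlowup.step q Finset.univ j₀ b₀ s) :=
    direction_mem_resVertex_of_shade_eq j₁ hb₁ ho₁ hr₁ hqo₁ ho₁2 heq₁
  have hdirj : direction j₁ b₁ j₀ = 0 := by
    unfold direction
    rw [Function.update_of_ne (Ne.symm hj)]
    exact hb
  have hmem : direction j₁ b₁ ∈ resVertex (CentreBlowup.step q Finset.univ j₀ b₀ s) ⊓ hyperplane j₀ :=
    Submodule.mem_inf.mpr ⟨hdir, mem_hyperplane.mpr hdirj⟩
  rw [hbot, Submodule.mem_bot] at hmem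
  have h1 : direction j₁ b₁ j₁ = 1 := by
    unfold direction
    exact Function.update_self ..
  rw [hmem, Pi.zero_apply] at h1
  exact zero_ne_one h1

end VertexDrop

/-! ## 3. Assembly with the free-tail lemma: the `e_G ≤ 1` case of K2(p), every prime -/

/-- **No isolated above-floor chain with eventually constant shade and eventually `e_G ≤ 1`** (every
prime `p`, characteristic `p`): FT(p,p) supplies a satellite step beyond the threshold, (E1-FREE) forbids
it. [OURS] [cite: CossartJannsenSaito2020, Thm. 3.14] -/
theorem no_isolated_chain_eventually_vertex_le_one (p : ℕ) [Fact p.Prime] [CharP K p] [DecidableEq K]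
    {c : ℕ → State K} (hc : ∀ k, IsIsolated p (c k).F ∧ Step0 p (c k) (c (k + 1)))
    (hr0 : ∀ e ∈ (c 0).F.support, (c 0).r ≤ e) (hfloor : ∀ k, ordZero (c k).F ≠ p) {k₀ : ℕ} {d : ℕ∞}
    (hshade : ∀ k, k₀ ≤ k → (c k).shade = d)
    (he : ∀ k, k₀ ≤ k → Module.finrank K (resVertex (c k)) ≤ 1) : False := by
  obtain ⟨j, b, hw⟩ := FreeTail.exists_witnesses (K := K) (fun k => (hc k).2)
  have hFT := (FreeTail.satelliteRecurrenceAt_iff_noIsolatedFreeTailAt p p).mpr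
    (FreeTailProof.noIsolatedFreeTailAt_self p)
  obtain ⟨k, hk, hsat⟩ := hFT K c j b hw (fun k => (hc k).1) k₀
  have band : ∀ m, ∃ o : ℕ, ordZero (c m).F = o ∧ p < o ∧ o < 2 * p := fun m => by
    obtain ⟨o, ho, hpo, ho2⟩ := BandShade.exists_ordZero_eq p hc m
    refine ⟨o, ho, lt_of_le_of_ne hpo (fun h => hfloor m (by rw [ho, h])), ?_⟩
    have hp : 2 ≤ p := (Fact.out : p.Prime).two_le
    omega
  obtain ⟨o₀, ho₀, hpo₀, ho₀2⟩ := band k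
  obtain ⟨o₁, ho₁, hpo₁, ho₁2⟩ := band (k + 1)
  have hr := IsolatedBand.isolated_chain_forall_le hc hr0
  obtain ⟨-, hbk, -, -, hck⟩ := hw k
  obtain ⟨-, hbk1, -, -, hck1⟩ := hw (k + 1)
  have heq₀ : (CentreBlowup.step p Finset.univ (j k) (b k) (c k)).shade = (c k).shade := by
    rw [← hck, hshade (k + 1) (by omega), hshade k hk]
  have heq₁ : (CentreBlowup.step p Finset.univ (j (k + 1)) (b (k + 1))
      (CentreBlowup.step p Finset.univ (j k) (b k) (c k))).shade =
      (CentreBlowup.step p Finset.univ (j k) (b k) (c k)).shade := by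
    rw [← hck, ← hck1, hshade (k + 2) (by omega), hshade (k + 1) (by omega)]
  have ho₁' : ordZero (CentreBlowup.step p Finset.univ (j k) (b k) (c k)).F = o₁ := by
    rw [← hck]; exact ho₁
  have hr₁ : ∀ d ∈ (CentreBlowup.step p Finset.univ (j k) (b k) (c k)).F.support,
      (CentreBlowup.step p Finset.univ (j k) (b k) (c k)).r ≤ d := by
    rw [← hck]; exact hr (k + 1)
  exact not_satellite_of_finrank_le_one hbk hbk1 ho₀ (hr k) hpo₀ ho₀2 heq₀ ho₁' hr₁ hpo₁ ho₁2 heq₁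
    (he k hk) hsat

/-- **THE `e_G ≤ 1` CASE OF K2(p) IS EMPTY, EVERY PRIME** (constant-shade trap form of
`BandShade.noAboveFloorTrap_iff_noConstantShadeTrap`, restricted to chains whose polar kernel has rank `≤ 1`
throughout): no isolated above-floor `Step0 p` chain with `x^{r₀} ∣ F₀`, constant shade and `e_G ≤ 1`.
The complementary cases `e_G ∈ {2, 3, 4}` are NOT treated here. [OURS] [cite: CossartJannsenSaito2020, Thm. 3.14] -/
theorem noConstantShadeTrap_of_vertex_le_one (p : ℕ) [Fact p.Prime] :
    ∀ (K : Type) [Field K] [CharP K p] [DecidableEq K],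
      ¬ ∃ (c : ℕ → State K) (d : ℕ∞), (∀ e ∈ (c 0).F.support, (c 0).r ≤ e) ∧
        (∀ k, IsIsolated p (c k).F ∧ Step0 p (c k) (c (k + 1)) ∧ ordZero (c k).F ≠ p ∧
          (c k).shade = d) ∧ ∀ k, Module.finrank K (resVertex (c k)) ≤ 1 := by
  intro K _ _ _
  rintro ⟨c, d, hr0, hc, he⟩
  exact no_isolated_chain_eventually_vertex_le_one p (fun k => ⟨(hc k).1, (hc k).2.1⟩) hr0
    (fun k => (hc k).2.2.1) (k₀ := 0) (fun k _ => (hc k).2.2.2) (fun k _ => he k)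

end ResCone

end Summit.ResolutionOfSingularities.ResolutionOfSingularities.Theorems.PIDim4

end
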